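import Literature.Geometry.Riemannian.RoundSphereVolume
import Literature.Geometry.Riemannian.ChangGurskyYangProofs
import Literature.Geometry.Riemannian.VolumeScaling
import Literature.Geometry.Lorentzian.PseudoRiemannianMetricProofs
import HarnessLib

/-!
# The shrinking round sphere `S⁴(√6)` as a gradient Ricci shrinker (topic `Geometry/Riemannian`)

The round 4-sphere of radius `√6`, `g = 6 • g_{S⁴(1)}` on Mathlib's `sphere (0 : ℝ⁵) 1`, with the
constant potential `f ≡ 2`, is the compact model shrinker of the 4-dimensional density table of
Cao–Hamilton–Ilmanen (2004, §4): `Ric + Hess f = ½ g`, `R + |∇f|² = f`, and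
`Θ(S⁴) = (4π)⁻² ∫ e^{-f} dV = 6/e² ≈ .812`, just ABOVE the cylinder `Θ(S³×ℝ) = 2√π e^{-3/2} ≈ .791`.
This file evaluates these clauses in the tree's vocabulary (`PseudoRiemannianMetric.ricci /
scalarCurvature / hessian / edist`, `Lorentzian.riemannianMeasure`):

* `ricci_roundMetric_four` (`Ric(g_{S⁴}) = 3 g_{S⁴}` for the Koszul connection, from the tree's
  `ricci_roundMetric_holds`), `ricci_shrinkingSphereFourMetric` (`Ric = ½ g` for `6 g_{S⁴}`, by
  `ricci_constSmul`), `scalarCurvature_shrinkingSphereFourMetric` (`R = 2`);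
* `hessian_constFun` (`Hess c = 0`), `isCompact_setOf_edist_shrinkingSphereFour_le` (closed
  distance balls are compact), `connectedSpace_sphereFour`;
* `lintegral_exp_neg_two_shrinkingSphereFour` — `∫ e^{-2} dV = e^{-2} · 6² · 8π²/3 = 96π²e⁻²`
  (`riemannianMeasure_roundMetric_sphere_four_univ`, `vol_constSmul_four`);
* `cylinderDensityBound_lt_shrinkingSphereFour` — `32π²√π e^{-3/2} < 96π² e^{-2}` (`πe < 9`).

Used by the refuter's negative lemma "non-compactness is load-bearing" for crux
`EntropyRung.NoncompactShrinkerGap` and relevant to `EntropyRung.CompactShrinkerGap` (the round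
`S⁴` satisfies its hypothesis `Θ > Θ(S³×ℝ)`). Everything is proved; no named facts.

## References

* H.-D. Cao, R. S. Hamilton, T. Ilmanen, *Gaussian densities and stability for some Ricci
  solitons*, arXiv:math/0404165 (2004), §4 (table: `S⁴ 6/e² .812`, `S³×ℝ .791`).
  [CaoHamiltonIlmanen2004]
* P. Topping, *Lectures on the Ricci flow*, CUP 2006, §1.2.1 (`Ric(g_{Sⁿ}) = (n-1) g`). [Topping2006]
* T. Aubin, *Nonlinear Analysis on Manifolds*, Springer 1982, Thm. 6.7 (`ω₄ = 8π²/3`). [Aubin1982]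
-/

noncomputable section

open Bundle Set Function Filter Manifold Metric Module MeasureTheory
open scoped Manifold ContDiff Topology RealInnerProductSpace ENNReal NNReal

namespace Literature.Geometry.Riemannian

open Lorentzian Lorentzian.PseudoRiemannianMetric

section ConstFun

variable {E : Type*} [NormedAddCommGroup E] [NormedSpace ℝ E] {H : Type*} [TopologicalSpace H]
  {I : ModelWithCorners ℝ E H} {M : Type*} [TopologicalSpace M] [ChartedSpace H M]
  [IsManifold I ∞ M] {n : ℕ∞ω}
  (g : PseudoRiemannianMetric I n E (TangentSpace I : M → Type _)) [g.HasLeviCivita]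

/-- **The Hessian of a constant function vanishes** (O'Neill 1983, Ch. 3, Def. 3.48); the same
statement as `Literature.Geometry.Lorentzian.hessian_const` (`BlackHoles.lean`), restated in the
Riemannian topic to avoid that import. [cite: ONeill1983, Ch. 3, Def. 3.48] -/
theorem _root_.Literature.Geometry.Lorentzian.PseudoRiemannianMetric.hessian_constFun (a : ℝ)
    (x : M) : g.hessian (fun _ ↦ a) x = 0 := by
  have haux : ∀ X Y : Π x : M, TangentSpace I x, g.hessianAux (fun _ ↦ a) X Y x = 0 := by
    intro X Y
    simp [PseudoRiemannianMetric.hessianAux, mvfderiv_const]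
  unfold PseudoRiemannianMetric.hessian
  have hex : ∃ B : LinearMap.BilinForm ℝ (TangentSpace I x), ∀ X₀ Y₀ : TangentSpace I x,
      B X₀ Y₀ =
        g.hessianAux (fun _ ↦ a) (FiberBundle.extend E X₀) (FiberBundle.extend E Y₀) x :=
    ⟨0, fun _ _ ↦ by simp [haux]⟩
  rw [dif_pos hex]
  ext X₀ Y₀
  simpa [haux] using hex.choose_spec X₀ Y₀

end ConstFun

section Sphere

/-- Euclidean `ℝ⁵`. [folklore] -/
abbrev EuclideanFive : Type := EuclideanSpace ℝ (Fin 5)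

/-- `dim ℝ⁵ = 4 + 1`, the form Mathlib's sphere charts consume. [folklore] -/
instance factFinrankEuclideanFive : Fact (finrank ℝ EuclideanFive = 4 + 1) :=
  ⟨finrank_euclideanSpace_fin⟩

/-- The unit sphere `S⁴ ⊂ ℝ⁵` with Mathlib's manifold structure (stereographic charts in `ℝ⁴`,
model `𝓡 4`), the target of `SmoothPoincare4`. [folklore] -/
abbrev SphereFour : Type := sphere (0 : EuclideanFive) 1

/-- `0 < 6`. [folklore] -/
theorem six_pos' : (0 : ℝ) < 6 := by norm_num

/-- **The shrinking round sphere `S⁴(√6)`**: the metric `6 • g_{S⁴(1)}` on the unit sphere, i.e.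
the round metric of radius `√6`, normalised so that `Ric = ½ g` (the gradient shrinking soliton
normalisation `Ric + Hess f = g/2` with `f ≡ 2`; Cao–Hamilton–Ilmanen 2004, §4).
[cite: CaoHamiltonIlmanen2004, §4] -/
def shrinkingSphereFourMetric :
    PseudoRiemannianMetric (𝓡 4) ∞ (EuclideanSpace ℝ (Fin 4)) (TangentSpace (𝓡 4) : SphereFour → Type _) :=
  (roundMetric (n := 4) EuclideanFive).constSmul 6 six_pos'.ne'

/-- Unfolding lemma. [folklore] -/
theorem shrinkingSphereFourMetric_def :
    shrinkingSphereFourMetric = (roundMetric (n := 4) EuclideanFive).constSmul 6 six_pos'.ne' := rfl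

/-- `6 • g_{S⁴}` is Riemannian. [folklore] -/
theorem isRiemannian_shrinkingSphereFourMetric : shrinkingSphereFourMetric.IsRiemannian :=
  isRiemannian_roundMetric.constSmul six_pos'

/-- Levi-Civita instance for the round metric of `S⁴`. [folklore] -/
instance instHasLeviCivitaRoundFour : (roundMetric (n := 4) EuclideanFive).HasLeviCivita :=
  (roundMetric (n := 4) EuclideanFive).hasLeviCivita

/-- Levi-Civita instance for `6 • g_{S⁴}`. [folklore] -/
instance instHasLeviCivitaShrinkingSphereFour : shrinkingSphereFourMetric.HasLeviCivita :=
  shrinkingSphereFourMetric.hasLeviCivita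

/-- Levi-Civita instance for `6 • g_{S⁴}` in unfolded form. [folklore] -/
instance instHasLeviCivitaRoundFourSmul :
    ((roundMetric (n := 4) EuclideanFive).constSmul 6 six_pos'.ne').HasLeviCivita :=
  shrinkingSphereFourMetric.hasLeviCivita

/-- **`Ric(g_{S⁴(1)}) = 3 g`** for the tree's Koszul connection (`ricci_roundMetric_holds` at
`cov = leviCivita`; Topping 2006, §1.2.1). [cite: Topping2006, §1.2.1] -/
theorem ricci_roundMetric_four (y : SphereFour) (v w : TangentSpace (𝓡 4) y) :
    (roundMetric (n := 4) EuclideanFive).ricci y v w = 3 * (roundMetric (n := 4) EuclideanFive).val y v w := by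
  have h := ricci_roundMetric_holds EuclideanFive 4 (roundMetric (n := 4) EuclideanFive).leviCivita
    (roundMetric (n := 4) EuclideanFive).isLeviCivita_leviCivita_holds y v w
  rw [PseudoRiemannianMetric.ricci_apply, h]
  norm_num

/-- **`S⁴(√6)` is an Einstein shrinker with `λ = ½`**: `Ric(6 g_{S⁴}) = ½ · (6 g_{S⁴})`.
[cite: CaoHamiltonIlmanen2004, §4] -/
theorem ricci_shrinkingSphereFourMetric (y : SphereFour) (v w : TangentSpace (𝓡 4) y) :
    shrinkingSphereFourMetric.ricci y v w = (1 / 2 : ℝ) * shrinkingSphereFourMetric.val y v w := by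
  have h : shrinkingSphereFourMetric.ricci y = (roundMetric (n := 4) EuclideanFive).ricci y :=
    (roundMetric (n := 4) EuclideanFive).ricci_constSmul 6 six_pos'.ne' y
  have hv : shrinkingSphereFourMetric.val y v w = 6 * (roundMetric (n := 4) EuclideanFive).val y v w :=
    constSmul_apply (roundMetric (n := 4) EuclideanFive) 6 six_pos'.ne' y v w
  rw [h, ricci_roundMetric_four, hv]
  ring

/-- **`R(S⁴(√6)) = 2`** (`= n λ · 2 = 4 · ½`). [cite: CaoHamiltonIlmanen2004, §4] -/
theorem scalarCurvature_shrinkingSphereFourMetric (y : SphereFour) :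
    shrinkingSphereFourMetric.scalarCurvature y = 2 := by
  have hr : shrinkingSphereFourMetric.ricci y = (1 / 2 : ℝ) • shrinkingSphereFourMetric.toBilinForm y := by
    refine LinearMap.ext₂ fun v w ↦ ?_
    rw [ricci_shrinkingSphereFourMetric, LinearMap.smul_apply, LinearMap.smul_apply, toBilinForm_apply, smul_eq_mul]
  unfold PseudoRiemannianMetric.scalarCurvature
  rw [hr]
  simp only [PseudoRiemannianMetric.trace, LinearMap.comp_smul, map_smul, smul_eq_mul]
  have ht := trace_toBilinForm_holds shrinkingSphereFourMetric y
  rw [PseudoRiemannianMetric.trace] at ht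
  rw [ht, finrank_euclideanSpace_fin]
  norm_num

/-- Completeness in the form used by route statements: closed balls of the Riemannian distance of
`S⁴(√6)` are compact (closed subsets of a compact space). [folklore] -/
theorem isCompact_setOf_edist_shrinkingSphereFour_le (x : SphereFour) (r : NNReal) :
    IsCompact {y : SphereFour | shrinkingSphereFourMetric.edist isRiemannian_shrinkingSphereFourMetric x y ≤ r} := by
  refine IsClosed.isCompact (isClosed_le ?_ continuous_const)
  exact (PseudoRiemannianMetric.continuous_edist isRiemannian_shrinkingSphereFourMetric).comp
    (Continuous.prodMk_right x)

/-- `S⁴` is connected. [folklore] -/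
instance connectedSpace_sphereFour : ConnectedSpace SphereFour := by
  refine isConnected_iff_connectedSpace.mp (isConnected_sphere ?_ (0 : EuclideanFive) zero_le_one)
  rw [← Module.finrank_eq_rank, finrank_euclideanSpace_fin]
  norm_num

/-- **The weighted volume of the shrinking sphere**: `∫_{S⁴(√6)} e^{-2} dV = e^{-2} · 6² · 8π²/3
= 96π² e^{-2} ≈ 128.2`, i.e. Gaussian density `Θ(S⁴) = (4π)^{-2} · 96π²e^{-2} = 6/e² ≈ .812`
(Cao–Hamilton–Ilmanen 2004, §4, table); from `Vol(S⁴) = 8π²/3`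
(`riemannianMeasure_roundMetric_sphere_four_univ`) and `Vol_{c g} = c² Vol_g`
(`vol_constSmul_four`). [cite: CaoHamiltonIlmanen2004, §4] -/
theorem lintegral_exp_neg_two_shrinkingSphereFour :
    ∫⁻ _ : SphereFour, ENNReal.ofReal (Real.exp (-(2 : ℝ)))
        ∂(riemannianMeasure (shrinkingSphereFourMetric.toContMDiffRiemannianMetric isRiemannian_shrinkingSphereFourMetric)) =
      ENNReal.ofReal (Real.exp (-2) * (6 ^ 2 * (8 * Real.pi ^ 2 / 3))) := by
  rw [lintegral_const]
  have h1 : riemannianMeasure (shrinkingSphereFourMetric.toContMDiffRiemannianMetric isRiemannian_shrinkingSphereFourMetric) univ = shrinkingSphereFourMetric.vol univ := by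
    rw [PseudoRiemannianMetric.vol, riemVolume_eq isRiemannian_shrinkingSphereFourMetric]
  have h2 : shrinkingSphereFourMetric.vol univ = ENNReal.ofReal (6 ^ 2) * (roundMetric (n := 4) EuclideanFive).vol univ :=
    vol_constSmul_four (roundMetric (n := 4) EuclideanFive) six_pos' univ
  have h3 : (roundMetric (n := 4) EuclideanFive).vol univ = ENNReal.ofReal (8 * Real.pi ^ 2 / 3) := by
    rw [PseudoRiemannianMetric.vol, riemVolume_eq isRiemannian_roundMetric]
    exact riemannianMeasure_roundMetric_sphere_four_univ EuclideanFive
  rw [h1, h2, h3, ← ENNReal.ofReal_mul (by positivity), ← ENNReal.ofReal_mul (by positivity)]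

/-- **The sphere sits above the cylinder in the density table**: `32π²√π e^{-3/2} < 96π² e^{-2}`,
i.e. `(4π)² Θ(S³×ℝ) < (4π)² Θ(S⁴)` (`.791 < .812`; equivalent to `πe < 9`).
[cite: CaoHamiltonIlmanen2004, §4] -/
theorem cylinderDensityBound_lt_shrinkingSphereFour :
    32 * Real.pi ^ 2 * Real.sqrt Real.pi * Real.exp (-(3 : ℝ) / 2) <
      Real.exp (-2) * (6 ^ 2 * (8 * Real.pi ^ 2 / 3)) := by
  have hπ := Real.pi_pos
  have h1 : Real.sqrt Real.pi * Real.exp (1 / 2) < 3 := by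
    have hsq : (Real.sqrt Real.pi * Real.exp (1 / 2)) ^ 2 < 3 ^ 2 := by
      rw [mul_pow, Real.sq_sqrt hπ.le, ← Real.exp_nat_mul]
      have h3 : ((2 : ℕ) : ℝ) * (1 / 2) = 1 := by norm_num
      rw [h3]
      have hpi : Real.pi < 3.1416 := Real.pi_lt_d4
      have he : Real.exp 1 < 2.7182818286 := Real.exp_one_lt_d9
      nlinarith [Real.exp_pos 1]
    exact lt_of_pow_lt_pow_left₀ 2 (by norm_num) hsq
  have h2 : Real.exp (-(3 : ℝ) / 2) = Real.exp (-2) * Real.exp (1 / 2) := by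
    rw [← Real.exp_add]; norm_num
  rw [h2]
  calc 32 * Real.pi ^ 2 * Real.sqrt Real.pi * (Real.exp (-2) * Real.exp (1 / 2))
      = 32 * Real.pi ^ 2 * Real.exp (-2) * (Real.sqrt Real.pi * Real.exp (1 / 2)) := by ring
    _ < 32 * Real.pi ^ 2 * Real.exp (-2) * 3 := mul_lt_mul_of_pos_left h1 (by positivity)
    _ = Real.exp (-2) * (6 ^ 2 * (8 * Real.pi ^ 2 / 3)) := by ring

end Sphere

end Literature.Geometry.Riemannian

end
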